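import Mathlib
import Summits.NavierStokesRegularity.NavierStokesRegularity.Theorems.SubOnsagerCeilingSideBranchParkingReduction
import Summits.NavierStokesRegularity.NavierStokesRegularity.Theorems.SubOnsagerCeilingSideBranchThresholdStep
import HarnessLib

/-!
# Route SubOnsagerCeiling — the transiting modes of `α_SB` RELAX in the TRUE dynamics (no ceiling),
# uniformly in small viscosity (helper file for item stmt-NavierStokesRegularity-25507 `OrthantTailCeiling`;
# `--supports`; def-free)

Unconditional packaging of brick «R-B» (`sideBranch_block_transit_relax`, p826753).  That theorem needs a cap
`Z` on the dead-end pockets; in the reductions of this lineage the cap came from the ASSUMED ceiling.  But a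
cap is available in the TRUE dynamics: every finite block of the non-negative `α_SB` lattice only loses energy
(`sideBranch_block_antitone`, p824157), so from a one-shell datum of energy `E₀` every pocket obeys
`½z_j(t)² ≤ B_j(t) ≤ B_j(0) = E₀`, i.e. `z_j ≤ √(2E₀)`.  Hence:

* `sideBranch_pocket_le_of_energy` — along a regular `ν`-viscous solution from a one-shell datum that is
  non-negative on the shells `≥ 0`: `z_j(t) ≤ √(2E₀)` for every shell `j` and `t ∈ [0,s]`;
* **`sideBranch_transit_relax`** — ANOMALOUS RELAXATION OF THE TRANSITING MODES (true dynamics): for every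
  one-shell datum `X₀` with `X₀ 0, X₀ 1, X₀ 2 ≥ 0`, `X₀ 3 = 0`, every depth `K` and level `ρ > 0`
  there are `T₀ > 0` and `ν₀ > 0` (before the solution) such that along EVERY regular `ν`-viscous solution
  (`0 < ν ≤ ν₀`) of `α_SB` on `[0,s]` from `X₀` that is non-negative on the shells `≥ 1`:
  `x_k(u) ≤ ρ` and `s_k(u) ≤ ρ` for all `k ≤ K`, `u ∈ [T₀, s]`.  No ceiling, no other hypothesis.

So whatever energy a finite block of `α_SB` still holds at late times sits in its dead-end pockets — the
positive half («anomalous relaxation survives the side drain») of the dichotomy behind the aside cruxes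
`OrthantTailCeiling` / `ForwardTailCeiling`; the other half (how much the pockets hold — the occupation /
parking bound, `…SideBranchOccupationHorizon.lean`) is open.  Compare Barbato–Flandoli–Morandin 2011, Thm. 6
(uniform energy relaxation for the bare Katz–Pavlović chain).

HONEST FRAMING: elementary real analysis of a Tao-type MODEL lattice ODE (route SubOnsagerCeiling, rung
TL-M2Break); nothing bears on Navier–Stokes regularity; no crux is settled here.
[cite: Tao2016AveragedNS, §4 (4.2)–(4.3)]; Katz–Pavlović couplings: [cite: BarbatoMorandinRomito2011, §2].
-/

noncomputable section

-- the sub-problem namespace `NavierStokesRegularity.NavierStokesRegularity` is the tree's layout (D-0017)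
set_option linter.dupNamespace false

namespace Summit.NavierStokesRegularity.NavierStokesRegularity.Theorems.SubOnsagerCeiling

open Set
open Literature.Analysis.FluidPDE.TaoCascade

section Solution

variable {ε₀ ν s : ℝ} {X : Fin 4 → ℤ → ℝ → ℝ} {X₀ : Fin 4 → ℝ}

/-- **Pockets are capped by the datum energy (true dynamics).** Along a regular solution of the `ν`-viscous
`α_SB` lattice on `[0,s]` (`ν ≥ 0`) from the one-shell datum `X₀`, no shells below `0`, non-negative on the
shells `≥ 0`: `z_j(t) ≤ √(2E₀)` for every `j` and `t ∈ [0,s]` (`½z_j² ≤ B_j(t) ≤ B_j(0) = E₀`). [this file] -/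
theorem sideBranch_pocket_le_of_energy (hε : 0 < ε₀) (hν : 0 ≤ ν)
    (hinit : ∀ (i : Fin 4) (k : ℤ), X i k 0 = if k = 0 then X₀ i else 0)
    (hlow : ∀ (i : Fin 4) (k : ℤ), k < 0 → ∀ t : ℝ, X i k t = 0)
    (hder : ∀ (i : Fin 4) (k : ℤ), ∀ t ∈ Icc (0 : ℝ) s, HasDerivWithinAt (X i k)
      (quadTerm ε₀ sideBranchTable X i k t - ν * (1 + ε₀) ^ ((2 : ℝ) * k) * X i k t)
      (Icc (0 : ℝ) s) t)
    (hpos : ∀ t ∈ Icc (0 : ℝ) s, ∀ (i : Fin 4) (k : ℤ), 0 ≤ k → 0 ≤ X i k t)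
    {t : ℝ} (ht : t ∈ Icc (0 : ℝ) s) (j : ℤ) :
    X 2 j t ≤ Real.sqrt (2 * ∑ i : Fin 4, (1 / 2 : ℝ) * X₀ i ^ 2) := by
  rcases lt_or_ge j 0 with hj | hj
  · rw [hlow 2 j hj t]; exact Real.sqrt_nonneg _
  · obtain ⟨n, rfl⟩ := Int.eq_ofNat_of_zero_le hj
    have hanti := sideBranch_block_antitone hε hν hlow hder hpos n le_rfl ht.1 ht.2
    -- the block `0..n` at time `0` holds `E₀`
    have hB0 : (∑ k ∈ Finset.range (n + 1), ∑ i : Fin 4, (1 / 2 : ℝ) * X i (k : ℤ) 0 ^ 2) =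
        ∑ i : Fin 4, (1 / 2 : ℝ) * X₀ i ^ 2 := by
      rw [Finset.sum_range_succ']
      have h1 : ∀ k : ℕ, (∑ i : Fin 4, (1 / 2 : ℝ) * X i ((k + 1 : ℕ) : ℤ) 0 ^ 2) = 0 := fun k =>
        Finset.sum_eq_zero fun i _ => by
          rw [hinit, if_neg (by push_cast; omega)]
          ring
      simp only [h1, Finset.sum_const_zero, zero_add]
      refine Finset.sum_congr rfl fun i _ => ?_
      rw [hinit, if_pos (by simp)]
    rw [hB0] at hanti
    -- the pocket at shell `n` is one term of the block at time `t`
    have hshell : (∑ i : Fin 4, (1 / 2 : ℝ) * X i (n : ℤ) t ^ 2) ≤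
        ∑ k ∈ Finset.range (n + 1), ∑ i : Fin 4, (1 / 2 : ℝ) * X i (k : ℤ) t ^ 2 :=
      Finset.single_le_sum (f := fun k : ℕ => ∑ i : Fin 4, (1 / 2 : ℝ) * X i (k : ℤ) t ^ 2)
        (fun k _ => Finset.sum_nonneg fun i _ => by positivity) (Finset.self_mem_range_succ n)
    have hz : (1 / 2 : ℝ) * X 2 (n : ℤ) t ^ 2 ≤ ∑ i : Fin 4, (1 / 2 : ℝ) * X i (n : ℤ) t ^ 2 :=
      Finset.single_le_sum (f := fun i => (1 / 2 : ℝ) * X i (n : ℤ) t ^ 2)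
        (fun i _ => by positivity) (Finset.mem_univ 2)
    have h5 : X 2 (n : ℤ) t ^ 2 ≤ 2 * ∑ i : Fin 4, (1 / 2 : ℝ) * X₀ i ^ 2 := by linarith
    calc X 2 (n : ℤ) t ≤ |X 2 (n : ℤ) t| := le_abs_self _
      _ = Real.sqrt (X 2 (n : ℤ) t ^ 2) := (Real.sqrt_sq_eq_abs _).symm
      _ ≤ Real.sqrt (2 * ∑ i : Fin 4, (1 / 2 : ℝ) * X₀ i ^ 2) := Real.sqrt_le_sqrt h5

end Solution

/-- **ANOMALOUS RELAXATION OF THE TRANSITING MODES OF `α_SB` (true dynamics, `ν`-uniform).**  For every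
one-shell datum `X₀` with `X₀ 0, X₀ 1, X₀ 2 ≥ 0`, `X₀ 3 = 0` (energy `E₀`), every depth `K` and every level
`ρ > 0` there are `T₀ > 0` and `ν₀ > 0` such that: along every regular solution of the `ν`-viscous `α_SB`
lattice on `[0,s]` with `0 < ν ≤ ν₀` from `X₀` (one-shell datum, no shells below `0`, continuous modes, exact
equation within `[0,s]`) that is non-negative on the shells `≥ 1`, **`x_k(u) ≤ ρ` and `s_k(u) ≤ ρ` for all
`k ≤ K` and `u ∈ [T₀, s]`**.  (Pocket cap `√(2E₀)` from `sideBranch_pocket_le_of_energy`, signs on shell `0`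
from the datum, then `sideBranch_block_transit_relax`.)  MODEL lattice only. [this file] -/
theorem sideBranch_transit_relax {ε₀ : ℝ} (hε : 0 < ε₀) {X₀ : Fin 4 → ℝ} (hX0 : 0 ≤ X₀ 0)
    (hX1 : 0 ≤ X₀ 1) (hX2 : 0 ≤ X₀ 2) (hX3 : X₀ 3 = 0) (K : ℕ) {ρ : ℝ} (hρ : 0 < ρ) :
    ∃ T₀ : ℝ, 0 < T₀ ∧ ∃ ν₀ : ℝ, 0 < ν₀ ∧
      ∀ ν : ℝ, 0 < ν → ν ≤ ν₀ → ∀ (s : ℝ) (X : Fin 4 → ℤ → ℝ → ℝ),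
        (∀ (i : Fin 4) (k : ℤ), X i k 0 = if k = 0 then X₀ i else 0) →
        (∀ (i : Fin 4) (k : ℤ), k < 0 → ∀ t : ℝ, X i k t = 0) →
        (∀ (i : Fin 4) (k : ℤ), Continuous (X i k)) →
        (∀ (i : Fin 4) (k : ℤ), ∀ t ∈ Icc (0 : ℝ) s, HasDerivWithinAt (X i k)
          (quadTerm ε₀ sideBranchTable X i k t - ν * (1 + ε₀) ^ ((2 : ℝ) * k) * X i k t)
          (Icc (0 : ℝ) s) t) →
        (∀ t ∈ Icc (0 : ℝ) s, ∀ (i : Fin 4) (k : ℤ), 1 ≤ k → 0 ≤ X i k t) →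
        ∀ u ∈ Icc T₀ s, ∀ k : ℕ, k ≤ K → X 0 (k : ℤ) u ≤ ρ ∧ X 1 (k : ℤ) u ≤ ρ := by
  set E₀ : ℝ := ∑ i : Fin 4, (1 / 2 : ℝ) * X₀ i ^ 2 with hE₀def
  set Z : ℝ := Real.sqrt (2 * E₀) + 1 with hZdef
  have hZ : 0 < Z := by have := Real.sqrt_nonneg (2 * E₀); rw [hZdef]; linarith
  obtain ⟨T₀, hT₀, ν₀, hν₀, hblock⟩ := sideBranch_block_transit_relax hε hZ K hρ
  refine ⟨T₀, hT₀, ν₀, hν₀, fun ν hν hνle s X hinit hlow hcont hder hpos u hu k hk => ?_⟩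
  -- signs on every shell `≥ 0`
  have hx00 : 0 ≤ X 0 0 0 := by rw [hinit 0 0]; simpa using hX0
  have hs00 : 0 ≤ X 1 0 0 := by rw [hinit 1 0]; simpa using hX1
  have hz00 : 0 ≤ X 2 0 0 := by rw [hinit 2 0]; simpa using hX2
  have hw0 : ∀ j : ℤ, X 3 j 0 = 0 := by
    intro j; rw [hinit 3 j]; by_cases hj : j = 0 <;> simp [hj, hX3]
  have hposAll : ∀ t ∈ Icc (0 : ℝ) s, ∀ (i : Fin 4) (j : ℤ), 0 ≤ j → 0 ≤ X i j t := by
    intro t ht i j hj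
    rcases lt_or_eq_of_le hj with hj1 | hj0
    · exact hpos t ht i j (by omega)
    · subst hj0
      fin_cases i
      · exact sideBranch_chain_zero_nonneg hlow hcont hder hx00 ht
      · exact sideBranch_side_zero_nonneg hε hcont hder hs00 ht
      · exact sideBranch_pocket_zero_nonneg hε hder hz00 ht
      · exact (sideBranch_idle_eq_zero hder 0 (hw0 0) ht).symm.le
  -- the pocket cap from the energy
  have hcap : ∀ t ∈ Icc (0 : ℝ) s, ∀ j : ℤ, X 2 j t ≤ Z := by
    intro t ht j
    have h1 := sideBranch_pocket_le_of_energy hε hν.le hinit hlow hder hposAll ht j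
    rw [hZdef]; linarith
  exact hblock ν hν hνle s X hlow hder hposAll hcap u hu k hk

end Summit.NavierStokesRegularity.NavierStokesRegularity.Theorems.SubOnsagerCeiling

end
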